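import Mathlib
import Literature.Analysis.FluidPDE.SuitableWeak
import Literature.Analysis.FluidPDE.KNSSLiouville
import Literature.Analysis.FluidPDE.LerayHopfProofs
import Summits.NavierStokesRegularity.NavierStokesRegularity.Theses.EulerZoomLiouville
import Summits.NavierStokesRegularity.NavierStokesRegularity.Theorems.TypeILiouvilleTypeIliouvilleNoTypeIIPowerGaugeSteady
import Summits.NavierStokesRegularity.NavierStokesRegularity.Theorems.EulerZoomLiouvillePowerGaugeEulerLiouvilleSteady
import Summits.NavierStokesRegularity.NavierStokesRegularity.Theorems.EulerZoomLiouvillePowerGaugeEulerLiouvilleTimePeriodic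
import Summits.NavierStokesRegularity.NavierStokesRegularity.Theorems.EulerZoomLiouvillePowerGaugeEulerLiouvilleSpacePeriodic
import HarnessLib

/-!
# The TRAVELING-WAVE stratum of the crux `EulerZoomLiouville.PowerGaugeEulerLiouville`
# (route №10 `EulerZoomLiouville`, item stmt-NavierStokesRegularity-19832) — every `ρ > 0`

Helper file (theorems only; `--supports stmt-NavierStokesRegularity-19832`, line `birth`, a stratum of
STUB 3 `stub_noCollapseFromZero`). Seat ns-typeII-p3 (cell ns-regularity-ideate §B, D-0081).

THE STRATUM. A member of Seregin's power-gauged ancient Euler class (`ρ > 0`) of TRAVELING-WAVE form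
`u(τ, y) = U(y − τ b)`, with a traveling weak gradient `H(τ, y) = G₀(y − τ b)` (`G₀` a.e.-strongly
measurable), vanishes a.e. — `powerGaugeEulerLiouville_travelingWave` — for EVERY velocity `b ∈ ℝ³`
(`b = 0` is the steady rung B, here imported from ns-typeII-p1's
`Theorems/EulerZoomLiouvillePowerGaugeEulerLiouvilleSteady.lean`).  This is the home of refuter1's example
class (REFUTER PASS of №10, R2: «with the A-gauge alone E is FALSE on (0,1/2] — a traveling Hill vortex /
Gavrilov's compactly supported steady flow has bounded a^{2ρ−1} sup ∫_{B_a}|u|²; the a²-long parabolic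
windows of the E- and D-gauges are what kill steady/traveling members»): the kernel now says so BY NAME.
Mechanism (FLOOR label, critic-2's K-READ 01 §K5 — `E`- and `A`-weight arithmetic only, no Euler system,
no pressure, no local energy inequality): at time `τ` the window ball `B(0, a)` sees `G₀` on `B(−τ b, a)`,
which contains a fixed ball `B(y₀, R)` for all `|τ| ≤ ℓ_a = (a − R − |y₀|)/|b| ≍ a/|b|`
(`lintegral_window_ge_of_travel`), so the `E`-gauge `∫∫_{Q_a}|H|²_F ≤ c a^{1−ρ}` (ns-typeII-p3's
`TimePeriodic.setLIntegral_window_le_of_gaugeE`) gives `ℓ_a ∫_{B(y₀,R)}|G₀|²_F ≤ c a^{1−ρ}`, i.e.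
`∫_{B(y₀,R)}|G₀|²_F ≲ a^{−ρ} → 0` (`ball_grad_eq_zero_of_travel`); hence `G₀ = 0` a.e., `H = 0` a.e. on
the slab, a.e. slice of `u` is a.e. constant (`PowerGaugeSteady.ae_slice_const_of_weakGradient_ae_zero`),
and the `A`-gauge kills the constants (`TimePeriodic.slice_const_eq_zero_of_gaugeA`).
`travelingWave_of_powerGaugeEulerLiouville` records the literal sub-case of the route decl.

WHAT THIS IS NOT: not NS, not the crux (OPEN on `0 < ρ ≤ 1/2` for genuinely transient members); the
GENERAL traveling stratum (arbitrary weak gradient `H`, not assumed to travel) needs the identification of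
`H` with a traveling representative (as in the time-periodic file) and is not done here. [folklore]
-/

noncomputable section

-- the summit and its single problem share the name `NavierStokesRegularity` (D-0017 nested layout)
set_option linter.dupNamespace false

open Set Function Filter Topology MeasureTheory Metric TopologicalSpace
open scoped NNReal ENNReal InnerProductSpace RealInnerProductSpace

namespace Summit.NavierStokesRegularity.NavierStokesRegularity.Theorems.PowerGaugeEulerLiouville.TravelingWave

open Literature.Analysis Literature.Analysis.FluidPDE
open Summit.NavierStokesRegularity.NavierStokesRegularity.Theorems.TypeIliouvilleNoTypeII
open Summit.NavierStokesRegularity.NavierStokesRegularity.Theorems.PowerGaugeEulerLiouville.TimePeriodic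
open Summit.NavierStokesRegularity.NavierStokesRegularity.Theorems.PowerGaugeEulerLiouville.SpacePeriodic

/-! ## (1) The window sees a fixed ball for a time of length `≍ a/|b|` -/

/-- **One slice**: if `|y₀| + |τ| |b| + R ≤ a`, the traveling gradient's energy on the window ball
dominates its energy on the fixed ball: `∫_{B(0,a)} |G₀(y − τ b)|² ≥ ∫_{B(y₀,R)} |G₀|²`
(`B(0,a) − τ b = B(−τ b, a) ⊇ B(y₀, R)`). [folklore] -/
theorem slice_ball_ge_of_travel (g : EuclideanSpace ℝ (Fin 3) → ℝ≥0∞) {b y₀ : EuclideanSpace ℝ (Fin 3)}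
    {R a τ : ℝ} (h : ‖y₀‖ + |τ| * ‖b‖ + R ≤ a) :
    ∫⁻ y in ball y₀ R, g y ≤ ∫⁻ y in ball (0 : EuclideanSpace ℝ (Fin 3)) a, g (y - τ • b) := by
  have htr : ∫⁻ y in ball (0 : EuclideanSpace ℝ (Fin 3)) a, g (y - τ • b) = ∫⁻ y in ball (-(τ • b)) a, g y := by
    rw [setLIntegral_ball_translate g (-(τ • b)) a]
    simp_rw [sub_eq_add_neg]
  rw [htr]
  refine lintegral_mono_set fun y hy => ?_
  rw [mem_ball, dist_eq_norm] at hy ⊢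
  calc ‖y - -(τ • b)‖ = ‖(y - y₀) + (y₀ + τ • b)‖ := by congr 1; abel
    _ ≤ ‖y - y₀‖ + ‖y₀ + τ • b‖ := norm_add_le _ _
    _ ≤ ‖y - y₀‖ + (‖y₀‖ + ‖τ • b‖) := by linarith [norm_add_le y₀ (τ • b)]
    _ < R + (‖y₀‖ + |τ| * ‖b‖) := by rw [norm_smul, Real.norm_eq_abs]; linarith
    _ ≤ a := by linarith

/-- **The window integral of a traveling gradient dominates `ℓ · ∫_{B(y₀,R)} |G₀|²`** for every
`ℓ ≤ a²` with `|y₀| + ℓ |b| + R ≤ a` (Tonelli over the window — the sheared integrand being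
a.e.-measurable there — then `slice_ball_ge_of_travel` for `τ ∈ ]−ℓ, 0[`). [folklore] -/
theorem lintegral_window_ge_of_travel
    {G₀ : EuclideanSpace ℝ (Fin 3) → EuclideanSpace ℝ (Fin 3) →L[ℝ] EuclideanSpace ℝ (Fin 3)}
    {b y₀ : EuclideanSpace ℝ (Fin 3)} {R a ℓ : ℝ}
    (hm : AEMeasurable (fun z : ℝ × EuclideanSpace ℝ (Fin 3) => ENNReal.ofReal (frobeniusNormSq (G₀ (z.2 - z.1 • b))))
      (volume.restrict (Ioo (-(a ^ 2)) 0 ×ˢ ball (0 : EuclideanSpace ℝ (Fin 3)) a)))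
    (hℓa : ℓ ≤ a ^ 2) (h : ‖y₀‖ + ℓ * ‖b‖ + R ≤ a) :
    ENNReal.ofReal ℓ * ∫⁻ y in ball y₀ R, ENNReal.ofReal (frobeniusNormSq (G₀ y)) ≤
      ∫⁻ z in Ioo (-(a ^ 2)) 0 ×ˢ ball (0 : EuclideanSpace ℝ (Fin 3)) a,
        ENNReal.ofReal (frobeniusNormSq (G₀ (z.2 - z.1 • b))) := by
  set f : EuclideanSpace ℝ (Fin 3) → ℝ≥0∞ := fun y => ENNReal.ofReal (frobeniusNormSq (G₀ y)) with hf
  set Z : ℝ≥0∞ := ∫⁻ y in ball y₀ R, f y with hZ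
  -- Tonelli over the window
  have hμ : (volume : Measure (ℝ × EuclideanSpace ℝ (Fin 3))).restrict
      (Ioo (-(a ^ 2)) 0 ×ˢ ball (0 : EuclideanSpace ℝ (Fin 3)) a) =
      (volume.restrict (Ioo (-(a ^ 2)) 0)).prod (volume.restrict (ball (0 : EuclideanSpace ℝ (Fin 3)) a)) := by
    rw [Measure.volume_eq_prod, Measure.prod_restrict]
  rw [hμ] at hm ⊢
  rw [lintegral_prod _ hm]
  -- shrink the time window to `]−ℓ, 0[` and bound each slice from below by `Z`
  have hsub : Ioo (-ℓ) 0 ⊆ Ioo (-(a ^ 2)) 0 := Ioo_subset_Ioo (by linarith) le_rfl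
  calc ENNReal.ofReal ℓ * Z = ∫⁻ τ in Ioo (-ℓ) 0, Z := by
        rw [setLIntegral_const, Real.volume_Ioo, show (0 : ℝ) - -ℓ = ℓ by ring, mul_comm]
    _ ≤ ∫⁻ τ in Ioo (-ℓ) 0, ∫⁻ y in ball (0 : EuclideanSpace ℝ (Fin 3)) a, f (y - τ • b) := by
        refine setLIntegral_mono' measurableSet_Ioo fun τ hτ => ?_
        refine slice_ball_ge_of_travel f ?_
        have h1 : |τ| ≤ ℓ := by rw [abs_of_neg hτ.2]; linarith [hτ.1]
        nlinarith [norm_nonneg b]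
    _ ≤ ∫⁻ τ in Ioo (-(a ^ 2)) 0, ∫⁻ y in ball (0 : EuclideanSpace ℝ (Fin 3)) a, f (y - τ • b) :=
        lintegral_mono_set hsub

/-! ## (2) The traveling gradient vanishes -/

/-- **Every ball energy of the traveling gradient vanishes** (`b ≠ 0`, `ρ > 0`): with `a = n` and
`ℓ_n = (n − R − |y₀|)/|b|`, the `E`-gauge `∫∫_{Q_n}|H|²_F ≤ c n^{1−ρ}` and `lintegral_window_ge_of_travel`
give `∫_{B(y₀,R)}|G₀|²_F ≤ 2c|b| n^{−ρ} → 0`. [folklore] -/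
theorem ball_grad_eq_zero_of_travel {ρ : ℝ} (hρ : 0 < ρ) {c : ℝ≥0}
    {G₀ : EuclideanSpace ℝ (Fin 3) → EuclideanSpace ℝ (Fin 3) →L[ℝ] EuclideanSpace ℝ (Fin 3)}
    {b : EuclideanSpace ℝ (Fin 3)} (hb : b ≠ 0)
    (hm : ∀ a : ℝ, 0 < a → AEMeasurable
      (fun z : ℝ × EuclideanSpace ℝ (Fin 3) => ENNReal.ofReal (frobeniusNormSq (G₀ (z.2 - z.1 • b))))
      (volume.restrict (Ioo (-(a ^ 2)) 0 ×ˢ ball (0 : EuclideanSpace ℝ (Fin 3)) a)))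
    (hE : ∀ a : ℝ, 0 < a → ENNReal.ofReal (a ^ ρ) *
      cknE a (0 : ℝ × EuclideanSpace ℝ (Fin 3)) (fun τ y => G₀ (y - τ • b)) ≤ (c : ℝ≥0∞))
    (y₀ : EuclideanSpace ℝ (Fin 3)) {R : ℝ} (hR : 0 < R) :
    ∫⁻ y in ball y₀ R, ENNReal.ofReal (frobeniusNormSq (G₀ y)) = 0 := by
  set Z : ℝ≥0∞ := ∫⁻ y in ball y₀ R, ENNReal.ofReal (frobeniusNormSq (G₀ y)) with hZ
  have hbpos : 0 < ‖b‖ := norm_pos_iff.2 hb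
  set K : ℝ := R + ‖y₀‖ with hK
  have hK0 : 0 < K := by have := norm_nonneg y₀; linarith
  -- for `n ≥ max(2K, 1/‖b‖ + K)`: `Z ≤ 2 c ‖b‖ n^{-ρ}`
  have key : ∀ᶠ n : ℕ in atTop, Z ≤ ENNReal.ofReal (2 * (c : ℝ) * ‖b‖ * (n : ℝ) ^ (-ρ)) := by
    have hev : ∀ᶠ n : ℕ in atTop, max (2 * K) (1 / ‖b‖ + K) ≤ (n : ℝ) :=
      tendsto_natCast_atTop_atTop.eventually_ge_atTop _
    filter_upwards [hev] with n hn
    have h2K : 2 * K ≤ n := le_trans (le_max_left _ _) hn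
    have h1b : 1 / ‖b‖ + K ≤ n := le_trans (le_max_right _ _) hn
    have hn0 : (0 : ℝ) < n := by linarith
    set ℓ : ℝ := ((n : ℝ) - K) / ‖b‖ with hℓ
    have hℓ0 : 0 ≤ ℓ := div_nonneg (by linarith) hbpos.le
    have hℓpos : 0 < ℓ := div_pos (by linarith) hbpos
    -- `ℓ ≤ n²`: `n − K ≤ ‖b‖ n²` since `n ≥ 1/‖b‖`
    have hℓa : ℓ ≤ (n : ℝ) ^ 2 := by
      rw [hℓ, div_le_iff₀ hbpos]
      have h1 : 1 ≤ ‖b‖ * n := by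
        have : 1 / ‖b‖ ≤ n := by linarith
        rwa [div_le_iff₀ hbpos, mul_comm] at this
      nlinarith
    have hfit : ‖y₀‖ + ℓ * ‖b‖ + R ≤ n := by
      rw [hℓ, div_mul_cancel₀ _ hbpos.ne']
      linarith
    have h1 := lintegral_window_ge_of_travel (hm n hn0) hℓa hfit
    have h2 := setLIntegral_window_le_of_gaugeE (H := fun τ y => G₀ (y - τ • b)) hn0 le_rfl le_rfl (hE n hn0)
    have h3 : ENNReal.ofReal ℓ * Z ≤ ENNReal.ofReal ((c : ℝ) * (n : ℝ) ^ (1 - ρ)) := h1.trans h2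
    -- divide by `ℓ`
    have h4 : Z ≤ ENNReal.ofReal ((c : ℝ) * (n : ℝ) ^ (1 - ρ)) / ENNReal.ofReal ℓ := by
      rw [ENNReal.le_div_iff_mul_le (Or.inl (ENNReal.ofReal_pos.2 hℓpos).ne') (Or.inl ENNReal.ofReal_ne_top),
        mul_comm]
      exact h3
    refine h4.trans ?_
    rw [← ENNReal.ofReal_div_of_pos hℓpos]
    refine ENNReal.ofReal_le_ofReal ?_
    -- `c n^{1-ρ} / ℓ = c ‖b‖ n^{1-ρ}/(n − K) ≤ 2 c ‖b‖ n^{-ρ}`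
    rw [hℓ, div_div_eq_mul_div, div_le_iff₀ (by linarith : (0 : ℝ) < n - K)]
    have hsplit : (n : ℝ) ^ (1 - ρ) = (n : ℝ) * (n : ℝ) ^ (-ρ) := by
      rw [Real.rpow_sub hn0, Real.rpow_one, Real.rpow_neg hn0.le, div_eq_mul_inv]
    rw [hsplit]
    have hc0 : 0 ≤ (c : ℝ) * ‖b‖ * (n : ℝ) ^ (-ρ) := by positivity
    nlinarith
  have hlim : Tendsto (fun n : ℕ => ENNReal.ofReal (2 * (c : ℝ) * ‖b‖ * (n : ℝ) ^ (-ρ))) atTop (𝓝 0) := by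
    have h1 : Tendsto (fun n : ℕ => ((n : ℝ)) ^ (-ρ)) atTop (𝓝 0) :=
      (tendsto_rpow_neg_atTop hρ).comp tendsto_natCast_atTop_atTop
    have h2 := h1.const_mul (2 * (c : ℝ) * ‖b‖)
    rw [mul_zero] at h2
    have h3 := ENNReal.tendsto_ofReal h2
    rwa [ENNReal.ofReal_zero] at h3
  exact le_antisymm (le_of_tendsto_of_tendsto tendsto_const_nhds hlim key) bot_le

/-- **The traveling gradient vanishes a.e. on the slab**: on each box `]−N−1, 0[ × B(0, N+1)` the window
integral is `∫_τ ∫_{B(−τb, N+1)} |G₀|²_F dτ = 0` (Tonelli + translation + `ball_grad_eq_zero_of_travel`).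
[folklore] -/
theorem weakGradient_ae_zero_of_travel {ρ : ℝ} (hρ : 0 < ρ) {c : ℝ≥0}
    {U : EuclideanSpace ℝ (Fin 3) → EuclideanSpace ℝ (Fin 3)}
    {G₀ : EuclideanSpace ℝ (Fin 3) → EuclideanSpace ℝ (Fin 3) →L[ℝ] EuclideanSpace ℝ (Fin 3)}
    {b : EuclideanSpace ℝ (Fin 3)} (hb : b ≠ 0)
    (hH : HasWeakSpatialGradientOn (slab (EuclideanSpace ℝ (Fin 3)) (Iio 0) isOpen_Iio)
      (fun τ y => U (y - τ • b)) (fun τ y => G₀ (y - τ • b)))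
    (hE : ∀ a : ℝ, 0 < a → ENNReal.ofReal (a ^ ρ) *
      cknE a (0 : ℝ × EuclideanSpace ℝ (Fin 3)) (fun τ y => G₀ (y - τ • b)) ≤ (c : ℝ≥0∞)) :
    ∀ᵐ z ∂(volume.restrict (Iio (0 : ℝ) ×ˢ (univ : Set (EuclideanSpace ℝ (Fin 3))))),
      (fun τ y => G₀ (y - τ • b)) z.1 z.2 = 0 := by
  set F : ℝ × EuclideanSpace ℝ (Fin 3) → ℝ≥0∞ :=
    fun z => ENNReal.ofReal (frobeniusNormSq (G₀ (z.2 - z.1 • b))) with hF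
  have hFm : AEMeasurable F (volume.restrict (Iio (0 : ℝ) ×ˢ (univ : Set (EuclideanSpace ℝ (Fin 3))))) := by
    have h1 : AEStronglyMeasurable (uncurry fun τ y => G₀ (y - τ • b))
        (volume.restrict (Iio (0 : ℝ) ×ˢ (univ : Set (EuclideanSpace ℝ (Fin 3))))) := by
      have := hH.locallyIntegrableOn_grad.aestronglyMeasurable
      simpa [slab] using this
    exact ((ENNReal.continuous_ofReal.comp LerayHopfProofs.continuous_frobeniusNormSq).comp_aestronglyMeasurable
      h1).aemeasurable
  have hwin : ∀ a : ℝ, 0 < a → AEMeasurable F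
      (volume.restrict (Ioo (-(a ^ 2)) 0 ×ˢ ball (0 : EuclideanSpace ℝ (Fin 3)) a)) :=
    fun a ha => hFm.mono_set (prod_mono (fun τ hτ => hτ.2) (subset_univ _))
  have hZ : ∀ (y₀ : EuclideanSpace ℝ (Fin 3)) {R : ℝ}, 0 < R →
      ∫⁻ y in ball y₀ R, ENNReal.ofReal (frobeniusNormSq (G₀ y)) = 0 :=
    fun y₀ R hR => ball_grad_eq_zero_of_travel hρ hb hwin hE y₀ hR
  -- on each box the mass vanishes
  have hbox : ∀ N : ℕ, ∀ᵐ z ∂(volume.restrict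
      (Ioo (-((N : ℝ) + 1)) 0 ×ˢ ball (0 : EuclideanSpace ℝ (Fin 3)) ((N : ℝ) + 1))), F z = 0 := by
    intro N
    have hsub : Ioo (-((N : ℝ) + 1)) 0 ×ˢ ball (0 : EuclideanSpace ℝ (Fin 3)) ((N : ℝ) + 1) ⊆
        Iio (0 : ℝ) ×ˢ (univ : Set (EuclideanSpace ℝ (Fin 3))) :=
      prod_mono (fun τ hτ => hτ.2) (subset_univ _)
    have hFm' : AEMeasurable F (volume.restrict
        (Ioo (-((N : ℝ) + 1)) 0 ×ˢ ball (0 : EuclideanSpace ℝ (Fin 3)) ((N : ℝ) + 1))) :=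
      hFm.mono_set hsub
    refine (lintegral_eq_zero_iff' hFm').1 ?_
    have hμ : (volume : Measure (ℝ × EuclideanSpace ℝ (Fin 3))).restrict
        (Ioo (-((N : ℝ) + 1)) 0 ×ˢ ball (0 : EuclideanSpace ℝ (Fin 3)) ((N : ℝ) + 1)) =
        (volume.restrict (Ioo (-((N : ℝ) + 1)) 0)).prod
          (volume.restrict (ball (0 : EuclideanSpace ℝ (Fin 3)) ((N : ℝ) + 1))) := by
      rw [Measure.volume_eq_prod, Measure.prod_restrict]
    rw [hμ] at hFm' ⊢
    rw [lintegral_prod F hFm']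
    refine (lintegral_congr fun τ => ?_).trans lintegral_zero
    show ∫⁻ y in ball (0 : EuclideanSpace ℝ (Fin 3)) ((N : ℝ) + 1),
        ENNReal.ofReal (frobeniusNormSq (G₀ (y - τ • b))) = 0
    have htr : ∫⁻ y in ball (0 : EuclideanSpace ℝ (Fin 3)) ((N : ℝ) + 1),
        ENNReal.ofReal (frobeniusNormSq (G₀ (y - τ • b))) =
        ∫⁻ y in ball (-(τ • b)) ((N : ℝ) + 1), ENNReal.ofReal (frobeniusNormSq (G₀ y)) := by
      rw [setLIntegral_ball_translate (fun y => ENNReal.ofReal (frobeniusNormSq (G₀ y))) (-(τ • b)) ((N : ℝ) + 1)]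
      simp_rw [sub_eq_add_neg]
    rw [htr]
    exact hZ _ (by positivity)
  -- the boxes exhaust the slab
  have hU' : (Iio (0 : ℝ) ×ˢ (univ : Set (EuclideanSpace ℝ (Fin 3)))) =
      ⋃ N : ℕ, (Ioo (-((N : ℝ) + 1)) 0 ×ˢ ball (0 : EuclideanSpace ℝ (Fin 3)) ((N : ℝ) + 1)) := by
    ext z
    simp only [mem_prod, mem_Iio, mem_univ, and_true, mem_iUnion, mem_Ioo, mem_ball_zero_iff]
    constructor
    · intro hz
      obtain ⟨N, hN⟩ := exists_nat_gt (max (-z.1) ‖z.2‖)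
      exact ⟨N, ⟨by linarith [le_max_left (-z.1) ‖z.2‖], hz⟩, by linarith [le_max_right (-z.1) ‖z.2‖]⟩
    · rintro ⟨N, ⟨-, h2⟩, -⟩
      exact h2
  have hall : ∀ᵐ z ∂(volume.restrict (Iio (0 : ℝ) ×ˢ (univ : Set (EuclideanSpace ℝ (Fin 3))))), F z = 0 := by
    rw [hU', ae_restrict_iUnion_iff]
    exact hbox
  filter_upwards [hall] with z hz
  have h1 : frobeniusNormSq (G₀ (z.2 - z.1 • b)) ≤ 0 := ENNReal.ofReal_eq_zero.1 hz
  have h2 : ‖G₀ (z.2 - z.1 • b)‖ ^ 2 ≤ 0 := (sq_opNorm_le_frobeniusNormSq _).trans h1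
  exact norm_eq_zero.1 (by nlinarith [norm_nonneg (G₀ (z.2 - z.1 • b))])

/-! ## (3) The stratum -/

/-- **The TRAVELING-WAVE stratum of `EulerZoomLiouville.PowerGaugeEulerLiouville`, every `ρ > 0`.**  A
member of Seregin's power-gauged ancient Euler class of the form `u(τ, y) = U(y − τ b)` with traveling weak
gradient `H(τ, y) = G₀(y − τ b)` — steady in a frame moving with ANY constant velocity `b` — vanishes a.e.
on the slab: for `b = 0` this is the steady rung B (`powerGaugeEulerLiouville_steady`); for `b ≠ 0` the
`E`-gauge kills the gradient (`weakGradient_ae_zero_of_travel`), a.e. slice is then a.e. constant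
(`PowerGaugeSteady.ae_slice_const_of_weakGradient_ae_zero`) and the `A`-gauge kills the constants
(`TimePeriodic.slice_const_eq_zero_of_gaugeA`).  The Euler system and the local energy inequality are not
used. [folklore] -/
theorem powerGaugeEulerLiouville_travelingWave :
    ∀ ρ : ℝ, 0 < ρ → ∀ (U : EuclideanSpace ℝ (Fin 3) → EuclideanSpace ℝ (Fin 3))
      (p : ℝ → EuclideanSpace ℝ (Fin 3) → ℝ)
      (G₀ : EuclideanSpace ℝ (Fin 3) → EuclideanSpace ℝ (Fin 3) →L[ℝ] EuclideanSpace ℝ (Fin 3))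
      (c : NNReal) (b : EuclideanSpace ℝ (Fin 3)),
      Literature.Analysis.FluidPDE.IsSuitableWeakSolutionOn
          (Literature.Analysis.FluidPDE.slab (EuclideanSpace ℝ (Fin 3)) (Set.Iio 0) isOpen_Iio) 0 0
          (fun τ y => U (y - τ • b)) p →
      Literature.Analysis.FluidPDE.HasWeakSpatialGradientOn
          (Literature.Analysis.FluidPDE.slab (EuclideanSpace ℝ (Fin 3)) (Set.Iio 0) isOpen_Iio)
          (fun τ y => U (y - τ • b)) (fun τ y => G₀ (y - τ • b)) →
      (∀ a : ℝ, 0 < a →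
        ENNReal.ofReal (a ^ (2 * ρ)) *
            Literature.Analysis.FluidPDE.cknA a (0 : ℝ × EuclideanSpace ℝ (Fin 3)) (fun τ y => U (y - τ • b)) +
          ENNReal.ofReal (a ^ ρ) *
            Literature.Analysis.FluidPDE.cknE a (0 : ℝ × EuclideanSpace ℝ (Fin 3)) (fun τ y => G₀ (y - τ • b)) +
          ENNReal.ofReal (a ^ (2 * ρ)) *
            Literature.Analysis.FluidPDE.cknD a (0 : ℝ × EuclideanSpace ℝ (Fin 3)) p ≤
          (c : ENNReal)) →
      Function.uncurry (fun τ y => U (y - τ • b)) =ᵐ[volume.restrict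
        (Set.Iio (0 : ℝ) ×ˢ (Set.univ : Set (EuclideanSpace ℝ (Fin 3))))] 0 := by
  intro ρ hρ U p G₀ c b hsw hH hc
  by_cases hb : b = 0
  · -- the steady rung B (ns-typeII-p1)
    subst hb
    have e1 : (fun (τ : ℝ) (y : EuclideanSpace ℝ (Fin 3)) => U (y - τ • (0 : EuclideanSpace ℝ (Fin 3)))) =
        fun _ => U := by
      funext τ y; simp
    have e2 : (fun (τ : ℝ) (y : EuclideanSpace ℝ (Fin 3)) => G₀ (y - τ • (0 : EuclideanSpace ℝ (Fin 3)))) =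
        fun _ => G₀ := by
      funext τ y; simp
    rw [e1] at hsw
    rw [e1, e2] at hH hc
    rw [e1]
    exact powerGaugeEulerLiouville_steady ρ hρ U p (fun _ => G₀) c hsw hH hc
  · have hE : ∀ a : ℝ, 0 < a →
        ENNReal.ofReal (a ^ ρ) * cknE a (0 : ℝ × EuclideanSpace ℝ (Fin 3)) (fun τ y => G₀ (y - τ • b)) ≤
          (c : ℝ≥0∞) :=
      fun a ha => le_trans (le_trans le_add_self le_self_add) (hc a ha)
    have hA : ∀ a : ℝ, 0 < a → ENNReal.ofReal (a ^ (2 * ρ)) *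
        cknA a (0 : ℝ × EuclideanSpace ℝ (Fin 3)) (fun τ y => U (y - τ • b)) ≤ (c : ℝ≥0∞) :=
      fun a ha => le_trans (le_trans le_self_add le_self_add) (hc a ha)
    have hH0 := weakGradient_ae_zero_of_travel hρ hb hH hE
    have hslice := PowerGaugeSteady.ae_slice_const_of_weakGradient_ae_zero isOpen_Iio hH hH0
    have hzero : ∀ᵐ τ ∂(volume.restrict (Iio (0 : ℝ))),
        (fun τ y => U (y - τ • b)) τ =ᵐ[volume] 0 := by
      filter_upwards [hslice, ae_restrict_mem measurableSet_Iio] with τ hτ hτ0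
      obtain ⟨v, hv⟩ := hτ
      have hv0 : v = 0 := slice_const_eq_zero_of_gaugeA hρ hτ0 hv hA
      rw [hv0] at hv
      exact hv
    have hmeas : AEStronglyMeasurable (uncurry fun τ y => U (y - τ • b))
        (volume.restrict (Iio (0 : ℝ) ×ˢ (univ : Set (EuclideanSpace ℝ (Fin 3))))) := by
      have := hH.locallyIntegrableOn.aestronglyMeasurable
      simpa [slab] using this
    have h := ae_eq_zero_slab_of_ae_slice hmeas hzero
    filter_upwards [h] with z hz
    exact hz

/-- **The traveling-wave stratum is a literal sub-case of the crux**
`E = EulerZoomLiouville.PowerGaugeEulerLiouville` (stmt-NavierStokesRegularity-19832). [folklore] -/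
theorem travelingWave_of_powerGaugeEulerLiouville
    (hE : Summit.NavierStokesRegularity.NavierStokesRegularity.Theses.EulerZoomLiouville.PowerGaugeEulerLiouville) :
    ∀ ρ : ℝ, 0 < ρ → ∀ (U : EuclideanSpace ℝ (Fin 3) → EuclideanSpace ℝ (Fin 3))
      (p : ℝ → EuclideanSpace ℝ (Fin 3) → ℝ)
      (G₀ : EuclideanSpace ℝ (Fin 3) → EuclideanSpace ℝ (Fin 3) →L[ℝ] EuclideanSpace ℝ (Fin 3))
      (c : NNReal) (b : EuclideanSpace ℝ (Fin 3)),
      Literature.Analysis.FluidPDE.IsSuitableWeakSolutionOn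
          (Literature.Analysis.FluidPDE.slab (EuclideanSpace ℝ (Fin 3)) (Set.Iio 0) isOpen_Iio) 0 0
          (fun τ y => U (y - τ • b)) p →
      Literature.Analysis.FluidPDE.HasWeakSpatialGradientOn
          (Literature.Analysis.FluidPDE.slab (EuclideanSpace ℝ (Fin 3)) (Set.Iio 0) isOpen_Iio)
          (fun τ y => U (y - τ • b)) (fun τ y => G₀ (y - τ • b)) →
      (∀ a : ℝ, 0 < a →
        ENNReal.ofReal (a ^ (2 * ρ)) *
            Literature.Analysis.FluidPDE.cknA a (0 : ℝ × EuclideanSpace ℝ (Fin 3)) (fun τ y => U (y - τ • b)) +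
          ENNReal.ofReal (a ^ ρ) *
            Literature.Analysis.FluidPDE.cknE a (0 : ℝ × EuclideanSpace ℝ (Fin 3)) (fun τ y => G₀ (y - τ • b)) +
          ENNReal.ofReal (a ^ (2 * ρ)) *
            Literature.Analysis.FluidPDE.cknD a (0 : ℝ × EuclideanSpace ℝ (Fin 3)) p ≤
          (c : ENNReal)) →
      Function.uncurry (fun τ y => U (y - τ • b)) =ᵐ[volume.restrict
        (Set.Iio (0 : ℝ) ×ˢ (Set.univ : Set (EuclideanSpace ℝ (Fin 3))))] 0 :=
  fun ρ hρ U p G₀ c b hsw hH hc => hE ρ hρ (fun τ y => U (y - τ • b)) p (fun τ y => G₀ (y - τ • b)) c hsw hH hc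

end Summit.NavierStokesRegularity.NavierStokesRegularity.Theorems.PowerGaugeEulerLiouville.TravelingWave

end
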